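import Mathlib.Algebra.Order.BigOperators.Ring.Finset
import Mathlib.Algebra.Order.Chebyshev
import Mathlib.Data.Real.Basic
import Mathlib.Tactic.FieldSimp
import Mathlib.Tactic.GCongr
import Mathlib.Tactic.Linarith
import Mathlib.Tactic.Positivity
import Mathlib.Tactic.Ring
import HarnessLib

/-!
# The cone-coefficient inequality behind the Gursky–Viaclovsky `C¹` estimate (pure algebra)

Support file (pure finite-sum real algebra, no geometry and no `Literature` import) for the `C¹`
estimate along the Gursky–Viaclovsky `σ₂`-continuity path, the named fact
`Literature.Geometry.Riemannian.gurskyViaclovsky_gradientEstimate_weighted_four`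
(Gursky–Viaclovsky 2003, Prop. 5, whose algebraic heart is their Lemma 2 (§4), after Li–Li 2003
and Guan–Wang 2003).

At a maximum point of `γ = |∇f|²`, in an orthonormal eigenframe of `Hess f` (eigenvalues `μᵢ`,
`dᵢ = df(eᵢ)`, `γ = Σ dᵢ²`, first-order condition `μᵢ dᵢ = 0`), the Schouten-type field reads
`Wᵢⱼ = μᵢ δᵢⱼ + dᵢ dⱼ − ½ γ δᵢⱼ + Bᵢⱼ` with a background `|Bᵢⱼ| ≤ K`; the equation puts `W` in the
cone `Σ Wᵢⱼ² < c (tr W)²`, `tr W > 0`, `c ≥ 1`, and ellipticity leaves the good term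
`Q = Σᵢ (c tr W − Wᵢᵢ) μᵢ²`.

* **`sum_coneCoeff_mul_sq_ge`** — in dimension `4`, once `γ ≥ 16 K`, `Q ≥ tr W · γ² / 32`;
  `sum_coneCoeff_mul_sq_ge_of_eq` is the same statement with `γ` and `u = tr W` named.
* helpers: `sq_sum_sum_mul_mul_le` (Cauchy–Schwarz for the quadratic form `Σ dᵢ Wᵢⱼ dⱼ` on a
  finset) and `sq_div_two_sub_le_sum_sum_mul_mul` (`Σ dᵢ Wᵢⱼ dⱼ ≥ γ²/2 − K (Σ|dᵢ|)²`).

The proof is elementary: every coefficient `c tr W − Wᵢᵢ` is nonnegative on the cone; with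
`M = max μ`, either `c tr W − M + γ/2 − K ≥ γ/4`, and then `Q ≥ (γ/4) Σ μᵢ² ≥ (γ/16)(Σ μᵢ)²`
with `Σ μᵢ ≥ tr W + γ/2` (trace identity); or `M > c tr W`, and then the maximising index `i₁`
has `d_{i₁} = 0`, Cauchy–Schwarz for `Σ dᵢ Wᵢⱼ dⱼ ≥ γ²/4` off `i₁` gives
`Σ_{i,j ≠ i₁} Wᵢⱼ² ≥ γ²/16`, which the cone converts into `c tr W − W_{i₁i₁} ≥ γ²/(32 c tr W)`.

Everything is proved; no definition and no named fact is introduced.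

## References

* M. J. Gursky, J. A. Viaclovsky, *A fully nonlinear equation on four-manifolds with positive
  scalar curvature*, J. Differential Geom. 63 (2003) 131–154, §4, Lemma 2; Prop. 5.
  [GurskyViaclovsky2003]
* A. Li, Y. Y. Li, *On some conformally invariant fully nonlinear equations*, Comm. Pure Appl.
  Math. 56 (2003) 1416–1464. [LiLi2003]
* P. Guan, G. Wang, *Local estimates for a class of fully nonlinear equations arising from
  conformal geometry*, Int. Math. Res. Not. 2003:26, 1413–1432. [GuanWang2003]
-/

noncomputable section

namespace Literature.Geometry.Lorentzian

namespace MetricCoord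

/-! ### Two elementary finite-sum inequalities -/

/-- **Cauchy–Schwarz for a quadratic form on a finset**:
`(Σ_{i,j ∈ C} dᵢ Wᵢⱼ dⱼ)² ≤ (Σ_{i ∈ C} dᵢ²)² · Σ_{i,j ∈ C} Wᵢⱼ²` (the Cauchy–Schwarz inequality
for finite sums, applied in `j` and then in `i`). [folklore] -/
theorem sq_sum_sum_mul_mul_le {ι : Type*} (C : Finset ι) (d : ι → ℝ) (W : ι → ι → ℝ) :
    (∑ i ∈ C, ∑ j ∈ C, d i * W i j * d j) ^ 2 ≤
      (∑ i ∈ C, d i ^ 2) ^ 2 * ∑ i ∈ C, ∑ j ∈ C, W i j ^ 2 := by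
  have h1 : ∑ i ∈ C, ∑ j ∈ C, d i * W i j * d j = ∑ i ∈ C, d i * ∑ j ∈ C, W i j * d j := by
    refine Finset.sum_congr rfl fun i _ => ?_
    rw [Finset.mul_sum]
    exact Finset.sum_congr rfl fun j _ => by ring
  have h2 : ∀ i ∈ C, (∑ j ∈ C, W i j * d j) ^ 2 ≤ (∑ j ∈ C, W i j ^ 2) * ∑ j ∈ C, d j ^ 2 :=
    fun i _ => Finset.sum_mul_sq_le_sq_mul_sq C (W i) d
  rw [h1]
  calc (∑ i ∈ C, d i * ∑ j ∈ C, W i j * d j) ^ 2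
      ≤ (∑ i ∈ C, d i ^ 2) * ∑ i ∈ C, (∑ j ∈ C, W i j * d j) ^ 2 :=
        Finset.sum_mul_sq_le_sq_mul_sq C d fun i => ∑ j ∈ C, W i j * d j
    _ ≤ (∑ i ∈ C, d i ^ 2) * ∑ i ∈ C, (∑ j ∈ C, W i j ^ 2) * ∑ j ∈ C, d j ^ 2 :=
        mul_le_mul_of_nonneg_left (Finset.sum_le_sum h2)
          (Finset.sum_nonneg fun i _ => sq_nonneg _)
    _ = (∑ i ∈ C, d i ^ 2) ^ 2 * ∑ i ∈ C, ∑ j ∈ C, W i j ^ 2 := by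
        rw [← Finset.sum_mul]
        ring

/-- **The quadratic form of `W` along `d`**: if `μᵢ dᵢ = 0`, `|Bᵢⱼ| ≤ K`, `γ = Σ dₖ²` and
`Wᵢⱼ = μᵢ δᵢⱼ + dᵢ dⱼ − ½ γ δᵢⱼ + Bᵢⱼ`, then `Σᵢⱼ dᵢ Wᵢⱼ dⱼ ≥ γ²/2 − K (Σ |dᵢ|)²`
(the `μ`-term drops out, `Σ dᵢ² dⱼ² = γ²`, `½ γ Σ dᵢ² = ½ γ²`, and
`|Σ dᵢ Bᵢⱼ dⱼ| ≤ K (Σ|dᵢ|)²`). [folklore] -/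
theorem sq_div_two_sub_le_sum_sum_mul_mul {ι : Type*} [Fintype ι] [DecidableEq ι]
    (μ d : ι → ℝ) (B W : ι → ι → ℝ) {K γ : ℝ}
    (h0 : ∀ i, μ i * d i = 0) (hB : ∀ i j, |B i j| ≤ K) (hγ : ∑ k, d k ^ 2 = γ)
    (hW : ∀ i j, W i j = (if i = j then μ i else 0) + d i * d j
      - 1 / 2 * γ * (if i = j then 1 else 0) + B i j) :
    γ ^ 2 / 2 - K * (∑ i, |d i|) ^ 2 ≤ ∑ i, ∑ j, d i * W i j * d j := by
  -- termwise lower bound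
  have key : ∀ i j, d i ^ 2 * d j ^ 2 - 1 / 2 * γ * (if i = j then d j ^ 2 else 0)
      - K * |d i| * |d j| ≤ d i * W i j * d j := by
    intro i j
    have hKij : -(K * |d i| * |d j|) ≤ d i * B i j * d j := by
      have h1 : |d i * B i j * d j| ≤ K * |d i| * |d j| := by
        rw [abs_mul, abs_mul]
        calc |d i| * |B i j| * |d j| ≤ |d i| * K * |d j| :=
              mul_le_mul_of_nonneg_right (mul_le_mul_of_nonneg_left (hB i j) (abs_nonneg _))
                (abs_nonneg _)
          _ = K * |d i| * |d j| := by ring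
      linarith [neg_abs_le (d i * B i j * d j)]
    rw [hW i j]
    by_cases hij : i = j
    · rw [if_pos hij, if_pos hij, if_pos hij]
      subst hij
      have h0' : d i * μ i * d i = 0 := by rw [mul_comm (d i) (μ i), h0 i, zero_mul]
      nlinarith [hKij, h0']
    · rw [if_neg hij, if_neg hij, if_neg hij]
      nlinarith [hKij]
  -- row sums
  have hrow : ∀ i, γ / 2 * d i ^ 2 - K * (∑ j, |d j|) * |d i| ≤ ∑ j, d i * W i j * d j := by
    intro i
    calc γ / 2 * d i ^ 2 - K * (∑ j, |d j|) * |d i|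
        = ∑ j, (d i ^ 2 * d j ^ 2 - 1 / 2 * γ * (if i = j then d j ^ 2 else 0)
            - K * |d i| * |d j|) := by
          rw [Finset.sum_sub_distrib, Finset.sum_sub_distrib, ← Finset.mul_sum, ← Finset.mul_sum,
            ← Finset.mul_sum, hγ, Fintype.sum_ite_eq]
          ring
      _ ≤ ∑ j, d i * W i j * d j := Finset.sum_le_sum fun j _ => key i j
  calc γ ^ 2 / 2 - K * (∑ i, |d i|) ^ 2
      = ∑ i, (γ / 2 * d i ^ 2 - K * (∑ j, |d j|) * |d i|) := by
        rw [Finset.sum_sub_distrib, ← Finset.mul_sum, ← Finset.mul_sum, hγ]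
        ring
    _ ≤ ∑ i, ∑ j, d i * W i j * d j := Finset.sum_le_sum fun i _ => hrow i

/-! ### The cone-coefficient inequality -/

/-- **Gursky–Viaclovsky's `C¹` algebra (named-variable form).** In dimension `4`
(`Fintype.card ι = 4`), let `Wᵢⱼ = μᵢ δᵢⱼ + dᵢ dⱼ − ½ γ δᵢⱼ + Bᵢⱼ` with `μᵢ dᵢ = 0`, `|Bᵢⱼ| ≤ K`,
`γ = Σ dₖ²`, `u = Σ Wᵢᵢ > 0`, the cone condition `Σ Wᵢⱼ² < c u²` with `c ≥ 1`, and `γ ≥ 16 K`.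
Then `u γ² / 32 ≤ Σᵢ (c u − Wᵢᵢ) μᵢ²`. [cite: GurskyViaclovsky2003, Lemma 2 (§4)] -/
theorem sum_coneCoeff_mul_sq_ge_of_eq {ι : Type*} [Fintype ι] [DecidableEq ι]
    (hn : Fintype.card ι = 4) (μ d : ι → ℝ) (B W : ι → ι → ℝ) {K c γ u : ℝ} (hK : 0 ≤ K)
    (hc : 1 ≤ c) (h0 : ∀ i, μ i * d i = 0) (hB : ∀ i j, |B i j| ≤ K)
    (hγ : ∑ k, d k ^ 2 = γ) (huW : ∑ i, W i i = u)
    (hW : ∀ i j, W i j = (if i = j then μ i else 0) + d i * d j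
      - 1 / 2 * γ * (if i = j then 1 else 0) + B i j)
    (hu : 0 < u) (hcone : ∑ i, ∑ j, W i j ^ 2 < c * u ^ 2) (hγK : 16 * K ≤ γ) :
    u * γ ^ 2 / 32 ≤ ∑ i, (c * u - W i i) * μ i ^ 2 := by
  have hc0 : 0 < c := one_pos.trans_le hc
  have hγ0 : 0 ≤ γ := (mul_nonneg (by norm_num : (0 : ℝ) ≤ 16) hK).trans hγK
  have hcu : 0 < c * u := mul_pos hc0 hu
  -- (0) every diagonal entry is `< c u` on the cone, so every term of `Q` is nonnegative
  have hsq : ∀ i, W i i ^ 2 ≤ ∑ i, ∑ j, W i j ^ 2 := fun i =>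
    (Finset.single_le_sum (f := fun j => W i j ^ 2) (fun j _ => sq_nonneg (W i j))
      (Finset.mem_univ i)).trans
      (Finset.single_le_sum (f := fun i' => ∑ j, W i' j ^ 2)
        (fun i' _ => Finset.sum_nonneg fun j _ => sq_nonneg (W i' j)) (Finset.mem_univ i))
  have hdiag : ∀ i, W i i < c * u := fun i => by
    by_contra h
    push Not at h
    nlinarith [hsq i, mul_le_mul h h hcu.le (hcu.le.trans h),
      mul_nonneg (mul_nonneg hc0.le (sq_nonneg u)) (sub_nonneg.2 hc)]
  have hnn : ∀ i, 0 ≤ (c * u - W i i) * μ i ^ 2 := fun i =>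
    mul_nonneg (sub_nonneg.2 (hdiag i).le) (sq_nonneg _)
  -- (1) the case `γ = 0`
  rcases hγ0.eq_or_lt with hγz | hγpos
  · subst hγz
    rw [show u * (0 : ℝ) ^ 2 / 32 = 0 by ring]
    exact Finset.sum_nonneg fun i _ => hnn i
  -- (2) the trace identity: `Σ μᵢ ≥ u + γ - 4 K`
  have htr : u + γ - 4 * K ≤ ∑ i, μ i := by
    have h1 : ∀ i, W i i ≤ μ i + d i ^ 2 - γ / 2 + K := fun i => by
      rw [hW i i, if_pos rfl, if_pos rfl]
      nlinarith [(abs_le.1 (hB i i)).2]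
    have h2 : ∑ i, (μ i + d i ^ 2 - γ / 2 + K) = (∑ i, μ i) - γ + 4 * K := by
      simp only [Finset.sum_add_distrib, Finset.sum_sub_distrib, Finset.sum_const,
        Finset.card_univ, hn, nsmul_eq_mul, Nat.cast_ofNat, hγ]
      ring
    linarith [huW.symm.trans_le (Finset.sum_le_sum fun i _ => h1 i)]
  -- (3) the maximal eigenvalue
  have hne : (Finset.univ : Finset ι).Nonempty :=
    Finset.univ_nonempty_iff.2 (Fintype.card_pos_iff.1 (by omega))
  obtain ⟨i₁, -, hmax⟩ := Finset.exists_max_image Finset.univ μ hne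
  by_cases hT : γ / 4 ≤ c * u - μ i₁ + γ / 2 - K
  · -- Case A: every coefficient in front of a nonzero `μᵢ` is `≥ γ / 4`
    have hterm : ∀ i, γ / 4 * μ i ^ 2 ≤ (c * u - W i i) * μ i ^ 2 := by
      intro i
      by_cases hμ : μ i = 0
      · simp [hμ]
      · have hd : d i = 0 := (mul_eq_zero.1 (h0 i)).resolve_left hμ
        have hWii : W i i = μ i - γ / 2 + B i i := by
          rw [hW i i, if_pos rfl, if_pos rfl, hd]
          ring
        have hBii : B i i ≤ K := (abs_le.1 (hB i i)).2
        have hμM : μ i ≤ μ i₁ := hmax i (Finset.mem_univ i)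
        exact mul_le_mul_of_nonneg_right (by linarith) (sq_nonneg _)
    have hQ : γ / 4 * ∑ i, μ i ^ 2 ≤ ∑ i, (c * u - W i i) * μ i ^ 2 := by
      rw [Finset.mul_sum]
      exact Finset.sum_le_sum fun i _ => hterm i
    have hCSμ : (∑ i, μ i) ^ 2 ≤ 4 * ∑ i, μ i ^ 2 := by
      have h := sq_sum_le_card_mul_sum_sq (s := Finset.univ) (f := μ)
      simp only [Finset.card_univ, hn, Nat.cast_ofNat] at h
      exact h
    have h3 : (u + γ / 2) ^ 2 ≤ (∑ i, μ i) ^ 2 :=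
      pow_le_pow_left₀ (by linarith) (by linarith) 2
    nlinarith [mul_nonneg hγ0 (sub_nonneg.2 hCSμ), mul_nonneg hγ0 (sub_nonneg.2 h3),
      mul_nonneg hγ0 (sq_nonneg (u - γ / 2)), mul_nonneg hu.le (sq_nonneg γ)]
  · -- Case B: the maximal eigenvalue dominates, `μ_{i₁} > c u`, hence `d_{i₁} = 0`
    push Not at hT
    have hMA : c * u < μ i₁ := by linarith
    have hd1 : d i₁ = 0 := (mul_eq_zero.1 (h0 i₁)).resolve_left (hcu.trans hMA).ne'
    -- (B.i) the quadratic form along `d` is `≥ γ² / 4`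
    have hA : (∑ i, |d i|) ^ 2 ≤ 4 * γ := by
      have h := sq_sum_le_card_mul_sum_sq (s := Finset.univ) (f := fun i => |d i|)
      simp only [Finset.card_univ, hn, Nat.cast_ofNat, sq_abs, hγ] at h
      exact h
    have hS : γ ^ 2 / 4 ≤ ∑ i, ∑ j, d i * W i j * d j := by
      have h := sq_div_two_sub_le_sum_sum_mul_mul μ d B W h0 hB hγ hW
      nlinarith [mul_le_mul_of_nonneg_left hA hK, mul_le_mul_of_nonneg_right hγK hγ0]
    -- (B.ii) restrict to the indices `≠ i₁` and apply Cauchy–Schwarz there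
    have hSC : ∑ i, ∑ j, d i * W i j * d j
        = ∑ i ∈ {i₁}ᶜ, ∑ j ∈ {i₁}ᶜ, d i * W i j * d j := by
      rw [Fintype.sum_eq_add_sum_compl i₁]
      simp only [hd1, zero_mul, Finset.sum_const_zero, zero_add]
      refine Finset.sum_congr rfl fun i _ => ?_
      rw [Fintype.sum_eq_add_sum_compl i₁, hd1, mul_zero, zero_add]
    have hγC : ∑ i ∈ {i₁}ᶜ, d i ^ 2 = γ := by
      rw [← hγ, Fintype.sum_eq_add_sum_compl i₁, hd1]
      ring
    have hW' : γ ^ 2 / 16 ≤ ∑ i ∈ {i₁}ᶜ, ∑ j ∈ {i₁}ᶜ, W i j ^ 2 := by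
      have h1 : (γ ^ 2 / 4) ^ 2 ≤ (∑ i ∈ {i₁}ᶜ, ∑ j ∈ {i₁}ᶜ, d i * W i j * d j) ^ 2 :=
        pow_le_pow_left₀ (by positivity) (hS.trans_eq hSC) 2
      have h2 := sq_sum_sum_mul_mul_le {i₁}ᶜ d W
      rw [hγC] at h2
      refine le_of_mul_le_mul_left ?_ (pow_pos hγpos 2)
      calc γ ^ 2 * (γ ^ 2 / 16) = (γ ^ 2 / 4) ^ 2 := by ring
        _ ≤ γ ^ 2 * ∑ i ∈ {i₁}ᶜ, ∑ j ∈ {i₁}ᶜ, W i j ^ 2 := h1.trans h2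
    -- (B.iii) the cone inequality off the diagonal entry `W i₁ i₁`
    have hsplit : W i₁ i₁ ^ 2 + ∑ i ∈ {i₁}ᶜ, ∑ j ∈ {i₁}ᶜ, W i j ^ 2 ≤ ∑ i, ∑ j, W i j ^ 2 := by
      rw [Fintype.sum_eq_add_sum_compl i₁]
      refine add_le_add ?_ (Finset.sum_le_sum fun i _ => ?_)
      · exact Finset.single_le_sum (f := fun j => W i₁ j ^ 2) (fun j _ => sq_nonneg _)
          (Finset.mem_univ i₁)
      · exact Finset.sum_le_sum_of_subset_of_nonneg (Finset.subset_univ _)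
          fun j _ _ => sq_nonneg _
    -- (B.iv) conclusion: `Q ≥ (c u - W i₁ i₁) μ_{i₁}² ≥ (γ² / (32 c u)) (c u)² ≥ u γ² / 32`
    have hQ1 : (c * u - W i₁ i₁) * μ i₁ ^ 2 ≤ ∑ i, (c * u - W i i) * μ i ^ 2 :=
      Finset.single_le_sum (f := fun i => (c * u - W i i) * μ i ^ 2) (fun i _ => hnn i)
        (Finset.mem_univ i₁)
    have hAX : 0 ≤ c * u - W i₁ i₁ := sub_nonneg.2 (hdiag i₁).le
    have hcu2 : c * u ^ 2 ≤ (c * u) ^ 2 := by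
      nlinarith [mul_nonneg (mul_nonneg hc0.le (sq_nonneg u)) (sub_nonneg.2 hc)]
    have h1 : γ ^ 2 / 16 ≤ 2 * (c * u) * (c * u - W i₁ i₁) := by
      nlinarith [sq_nonneg (c * u - W i₁ i₁)]
    have h2 : (c * u) ^ 2 ≤ μ i₁ ^ 2 := pow_le_pow_left₀ hcu.le hMA.le 2
    have hAu : u ≤ c * u := le_mul_of_one_le_left hu.le hc
    nlinarith [mul_nonneg hAX (sub_nonneg.2 h2), mul_nonneg hcu.le (sub_nonneg.2 h1),
      mul_nonneg (by positivity : (0 : ℝ) ≤ γ ^ 2 / 16) (sub_nonneg.2 hAu)]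

/-- **Gursky–Viaclovsky's `C¹` algebra** (Gursky–Viaclovsky 2003, Lemma 2 (§4), in the
eigenframe of the Hessian; cf. Li–Li 2003, Guan–Wang 2003). In dimension `4`
(`Fintype.card ι = 4`), let `Wᵢⱼ = μᵢ δᵢⱼ + dᵢ dⱼ − ½ (Σ dₖ²) δᵢⱼ + Bᵢⱼ` with `μᵢ dᵢ = 0` (the
first-order condition at a maximum of `|∇f|²`), a background `|Bᵢⱼ| ≤ K`, `tr W = Σ Wᵢᵢ > 0`, the
cone condition `Σ Wᵢⱼ² < c (tr W)²` with `c ≥ 1`, and `Σ dₖ² ≥ 16 K`. Then the good term of the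
maximum principle dominates: `tr W · (Σ dₖ²)² / 32 ≤ Σᵢ (c tr W − Wᵢᵢ) μᵢ²`.
[cite: GurskyViaclovsky2003, Lemma 2 (§4)] -/
theorem sum_coneCoeff_mul_sq_ge {ι : Type*} [Fintype ι] [DecidableEq ι]
    (hn : Fintype.card ι = 4) (μ d : ι → ℝ) (B W : ι → ι → ℝ) {K c : ℝ} (hK : 0 ≤ K) (hc : 1 ≤ c)
    (h0 : ∀ i, μ i * d i = 0) (hB : ∀ i j, |B i j| ≤ K)
    (hW : ∀ i j, W i j = (if i = j then μ i else 0) + d i * d j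
      - 1 / 2 * (∑ k, d k ^ 2) * (if i = j then 1 else 0) + B i j)
    (hu : 0 < ∑ i, W i i) (hcone : ∑ i, ∑ j, W i j ^ 2 < c * (∑ i, W i i) ^ 2)
    (hγ : 16 * K ≤ ∑ k, d k ^ 2) :
    (∑ i, W i i) * (∑ k, d k ^ 2) ^ 2 / 32 ≤ ∑ i, (c * (∑ j, W j j) - W i i) * μ i ^ 2 :=
  sum_coneCoeff_mul_sq_ge_of_eq hn μ d B W hK hc h0 hB rfl rfl hW hu hcone hγ

end MetricCoord

end Literature.Geometry.Lorentzian
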